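import Literature.Probability.Percolation.LonePortSumGeneral
import Literature.Probability.Percolation.MooreShannonInfluenceBoundGeneral
import Summits.CriticalPhenomena.PercolationContinuityZ3.Theorems.PercNearOneGluingNoHeavyLowerTailThreePointIsoAsymOnePair
import Summits.CriticalPhenomena.PercolationContinuityZ3.Theorems.PercNearOneGluingNoHeavyLowerTailThreePointIsoSexticOneBond
import Summits.CriticalPhenomena.PercolationContinuityZ3.Theorems.PercNearOneGluingNoHeavyLowerTailThreePointIsoSexticSureComponent
import HarnessLib

/-!
# The asymmetric isolation laws `Q^{p+q} ≤ I_a^p · I_b^q · I_c` hold on EVERY finite weighted graph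

Support file for crux `stmt-CriticalPhenomena-4575` (`NoHeavyLowerTail`), seat `prim-l12-p1` gen 34 (`--supports stmt-CriticalPhenomena-4575`);
memo `run/shared/lean/prim/prim-l12/FROM-prim-l12-p1-g34-LV-CONE-ASYM-ISOLATION.md`.  No definitions, no sorries, standard axioms; unconditional.

Bond percolation `μ = prodBernoulli w` with ARBITRARY pair weights `w : Sym2 V → [0,1]` on a finite vertex type `V`, vertices `a, b, c`.
Isolation coordinates: `Q = μ(a|b|c) = μ((a↔b)ᶜ ∩ (a↔c)ᶜ ∩ (b↔c)ᶜ)`, `I_a = μ((a↔b)ᶜ ∩ (a↔c)ᶜ)`, `I_b = μ((a↔b)ᶜ ∩ (b↔c)ᶜ)`,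
`I_c = μ((a↔c)ᶜ ∩ (b↔c)ᶜ)`.

**THEOREM (`isoAsymPort_all`, `isoAsym_rpow`).**  For all reals `p, q ≥ 1` with `p² + pq + q² ≤ pq(p+q)` and every finite weighted graph:

  `Q^{p+q} ≤ I_a^p · I_b^q · I_c`.

The symmetric member `p = q = 3/2` is the sextic law `(Q6)` (`…ThreePointIsoSexticUniversal.isoSexticPort_all`, squared); the admissible
exponents form the region above the cubic curve `pq(p+q) = p² + pq + q²` through `(3/2, 3/2)` (parametrisation `p = (1+σ+σ²)/(σ(1+σ))`,
`q = σ·p`, `σ > 0`), which is EXACTLY where the one-pair convexity identity of `…ThreePointIsoAsymOnePair` is a sum of nonnegative terms.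
In logarithmic isolation coordinates `(Z, X, Y) = (log 1/I_c, log I_b/Q, log I_a/Q)` the family says `Y + σX ≥ c(σ)·Z` with
`c(σ) = σ(1+σ)/(1+σ+σ²)`; the series–parallel–fan ('tower') closure realises `c_LV(σ)` with `c_LV − c ≤ 4.2·10⁻³` (memo: the tower cone is
bounded by the unstable manifold of the Lotka–Volterra saddle `(1/3,1/3)`), so the family is near-sharp and `(Q6)` is its only member through
the tower fixed point.

Proof = the sextic template verbatim: induction on the number of fractional pairs; a fractional pair leaving the sure component of the port
is pivoted (`isoAsymPort_oneBond`: the four coordinates are affine in its weight, the termwise van den Berg–Häggström–Kahn inequalities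
`lonerAttachment_alone_le_allSep` give the decrement condition, and `ThreePointIsoAsymOnePair.asym_onePair_log` is the convexity/chord step);
the closed sure component gives equality (`coords_of_closedSure`).  The law is stated in logarithmic form
`Q = 0 ∨ (p+q) log Q ≤ p log I_a + q log I_b + log I_c` and converted to real powers at the end.
-/

namespace Summit.CriticalPhenomena.PercolationContinuityZ3.Theorems.ThreePointIsoAsymUniversal

open MeasureTheory Set Filter Topology Real
open Literature.Probability.Percolation Literature.Probability.LatticeModels
open Summit.CriticalPhenomena.PercolationContinuityZ3.Theorems.ThreePointIsoAsymOnePair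
open Summit.CriticalPhenomena.PercolationContinuityZ3.Theorems.ThreePointIsoSexticOneBond
open Summit.CriticalPhenomena.PercolationContinuityZ3.Theorems.ThreePointIsoSexticSureComponent
open scoped Classical

variable {V : Type*} [Fintype V]

/-! ## The closed sure component: the four coordinates -/

/-- **No fractional pair leaves the sure component: the coordinates.**  If `a, b ∉ K` (the vertices surely joined to `c`) and no pair `ux`,
`u ∈ K`, `x ∉ K`, has weight in `(0,1)`, then `I_c = 1` and `Q = I_b = I_a = μ(a ≁ b)` (the proof of
`ThreePointIsoSexticSureComponent.isoSexticPort_of_closedSure`, with its four equalities exported). [this work] -/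
theorem coords_of_closedSure (w : Sym2 V → unitInterval) {a b c : V}
    (hKa : ¬ (openGraph {e : Sym2 V | (w e : ℝ) = 1}).Reachable c a) (hKb : ¬ (openGraph {e : Sym2 V | (w e : ℝ) = 1}).Reachable c b)
    (hB : ¬ ∃ u x : V, (openGraph {e : Sym2 V | (w e : ℝ) = 1}).Reachable c u ∧ ¬ (openGraph {e : Sym2 V | (w e : ℝ) = 1}).Reachable c x ∧
      (0 : ℝ) < w s(u, x) ∧ (w s(u, x) : ℝ) < 1) :
    (prodBernoulli w).real ((openConn a c)ᶜ ∩ (openConn b c)ᶜ) = 1 ∧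
      (prodBernoulli w).real ((openConn a b)ᶜ ∩ (openConn a c)ᶜ ∩ (openConn b c)ᶜ) =
        (prodBernoulli w).real (openConn a b : Set (BondConfig V))ᶜ ∧
      (prodBernoulli w).real ((openConn a b)ᶜ ∩ (openConn b c)ᶜ) = (prodBernoulli w).real (openConn a b : Set (BondConfig V))ᶜ ∧
      (prodBernoulli w).real ((openConn a b)ᶜ ∩ (openConn a c)ᶜ) = (prodBernoulli w).real (openConn a b : Set (BondConfig V))ᶜ := by
  set μ := prodBernoulli w with hμ
  set G1 : SimpleGraph V := openGraph {e : Sym2 V | (w e : ℝ) = 1} with hG1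
  -- every pair leaving the sure component `K = {v | G1.Reachable c v}` has weight `0`
  have hzero : ∀ u x : V, G1.Reachable c u → ¬ G1.Reachable c x → (w s(u, x) : ℝ) = 0 := by
    intro u x hu hx
    have h0 : (0 : ℝ) ≤ w s(u, x) := (w s(u, x)).2.1
    have h1 : (w s(u, x) : ℝ) ≤ 1 := (w s(u, x)).2.2
    rcases h0.eq_or_lt with h | hpos
    · exact h.symm
    rcases h1.eq_or_lt' with h | hlt
    · exfalso
      have hux : u ≠ x := fun hux => hx (hux ▸ hu)
      have hadj : G1.Adj u x := by
        rw [hG1, openGraph_adj]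
        exact ⟨h.symm, hux⟩
      exact hx (hu.trans hadj.reachable)
    · exact (hB ⟨u, x, hu, hx, hpos, hlt⟩).elim
  -- hence almost surely all these pairs are closed
  have hclosed : ∀ᵐ ω ∂μ, ∀ u x : V, G1.Reachable c u → ¬ G1.Reachable c x → s(u, x) ∉ ω := by
    have : ∀ᵐ ω ∂μ, ∀ p : V × V, G1.Reachable c p.1 → ¬ G1.Reachable c p.2 → s(p.1, p.2) ∉ ω := by
      rw [ae_all_iff]
      rintro ⟨u, x⟩
      by_cases hux : G1.Reachable c u ∧ ¬ G1.Reachable c x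
      · have h0 : μ.real {ω | s(u, x) ∈ ω} = 0 := by rw [hμ, prodBernoulli_real_setOf_mem, hzero u x hux.1 hux.2]
        have h0' : μ {ω | s(u, x) ∈ ω} = 0 := (measureReal_eq_zero_iff (by finiteness)).1 h0
        filter_upwards [measure_eq_zero_iff_ae_notMem.1 h0'] with ω hω
        intro _ _
        simpa using hω
      · exact Eventually.of_forall fun ω h h' => (hux ⟨h, h'⟩).elim
    filter_upwards [this] with ω hω
    exact fun u x hu hx => hω (u, x) hu hx
  -- so almost surely the cluster of `c` is inside `K`
  have hcluster : ∀ᵐ ω ∂μ, ∀ v : V, (openGraph ω).Reachable c v → G1.Reachable c v := by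
    filter_upwards [hclosed] with ω hω
    intro v hv
    by_contra hKv
    obtain ⟨p⟩ := hv
    obtain ⟨d, -, hd1, hd2⟩ := p.exists_boundary_dart {y | G1.Reachable c y} (SimpleGraph.Reachable.refl c) hKv
    have hadj := d.adj
    rw [openGraph_adj] at hadj
    exact hω _ _ hd1 hd2 hadj.1
  have hac : ((openConn a c : Set (BondConfig V))ᶜ : Set (BondConfig V)) =ᵐ[μ] (univ : Set (BondConfig V)) := by
    rw [eventuallyEq_set]
    filter_upwards [hcluster] with ω hω
    simp only [mem_compl_iff, openConn, mem_setOf_eq, mem_univ, iff_true]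
    exact fun h => hKa (hω a h.symm)
  have hbc : ((openConn b c : Set (BondConfig V))ᶜ : Set (BondConfig V)) =ᵐ[μ] (univ : Set (BondConfig V)) := by
    rw [eventuallyEq_set]
    filter_upwards [hcluster] with ω hω
    simp only [mem_compl_iff, openConn, mem_setOf_eq, mem_univ, iff_true]
    exact fun h => hKb (hω b h.symm)
  refine ⟨?_, ?_, ?_, ?_⟩
  · rw [measureReal_congr (hac.inter hbc), inter_univ, probReal_univ]
  · rw [measureReal_congr ((EventuallyEq.rfl.inter hac).inter hbc), inter_univ, inter_univ]
  · rw [measureReal_congr (EventuallyEq.rfl.inter hbc), inter_univ]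
  · rw [measureReal_congr (EventuallyEq.rfl.inter hac), inter_univ]

/-! ## The law along one pair weight at the port -/

section Graph

variable [DecidableEq V]

/-- **The asymmetric law along the weight of one pair at the port.**  For admissible `p, q`, distinct `a, b, c`, any `x`, and `e = s(c, x)`:
if the logarithmic law `Q = 0 ∨ (p+q) log Q ≤ p log I_a + q log I_b + log I_c` holds for the weights `w[e ↦ 0]` and `w[e ↦ 1]`, then it
holds for `w`. [this work] -/
theorem isoAsymPort_oneBond {p q : ℝ} (hp : 1 ≤ p) (hq : 1 ≤ q) (hpq : p ^ 2 + p * q + q ^ 2 ≤ p * q * (p + q))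
    (w : Sym2 V → unitInterval) {a b c : V} (x : V) (hab : a ≠ b) (hac : a ≠ c) (hbc : b ≠ c)
    (h0 : (prodBernoulli (Function.update w s(c, x) 0)).real ((openConn a b)ᶜ ∩ (openConn a c)ᶜ ∩ (openConn b c)ᶜ) = 0 ∨
      (p + q) * log ((prodBernoulli (Function.update w s(c, x) 0)).real ((openConn a b)ᶜ ∩ (openConn a c)ᶜ ∩ (openConn b c)ᶜ)) ≤
        p * log ((prodBernoulli (Function.update w s(c, x) 0)).real ((openConn a b)ᶜ ∩ (openConn a c)ᶜ)) +
          q * log ((prodBernoulli (Function.update w s(c, x) 0)).real ((openConn a b)ᶜ ∩ (openConn b c)ᶜ)) +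
            log ((prodBernoulli (Function.update w s(c, x) 0)).real ((openConn a c)ᶜ ∩ (openConn b c)ᶜ)))
    (h1 : (prodBernoulli (Function.update w s(c, x) 1)).real ((openConn a b)ᶜ ∩ (openConn a c)ᶜ ∩ (openConn b c)ᶜ) = 0 ∨
      (p + q) * log ((prodBernoulli (Function.update w s(c, x) 1)).real ((openConn a b)ᶜ ∩ (openConn a c)ᶜ ∩ (openConn b c)ᶜ)) ≤
        p * log ((prodBernoulli (Function.update w s(c, x) 1)).real ((openConn a b)ᶜ ∩ (openConn a c)ᶜ)) +
          q * log ((prodBernoulli (Function.update w s(c, x) 1)).real ((openConn a b)ᶜ ∩ (openConn b c)ᶜ)) +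
            log ((prodBernoulli (Function.update w s(c, x) 1)).real ((openConn a c)ᶜ ∩ (openConn b c)ᶜ))) :
    (prodBernoulli w).real ((openConn a b)ᶜ ∩ (openConn a c)ᶜ ∩ (openConn b c)ᶜ) = 0 ∨
      (p + q) * log ((prodBernoulli w).real ((openConn a b)ᶜ ∩ (openConn a c)ᶜ ∩ (openConn b c)ᶜ)) ≤
        p * log ((prodBernoulli w).real ((openConn a b)ᶜ ∩ (openConn a c)ᶜ)) +
          q * log ((prodBernoulli w).real ((openConn a b)ᶜ ∩ (openConn b c)ᶜ)) +
            log ((prodBernoulli w).real ((openConn a c)ᶜ ∩ (openConn b c)ᶜ)) := by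
  set e : Sym2 V := s(c, x) with he
  set μ0 := prodBernoulli (Function.update w e 0) with hμ0
  set μ1 := prodBernoulli (Function.update w e 1) with hμ1
  set Sep : Set (BondConfig V) := (openConn a b)ᶜ ∩ (openConn a c)ᶜ ∩ (openConn b c)ᶜ with hSep
  set IA : Set (BondConfig V) := (openConn a b)ᶜ ∩ (openConn a c)ᶜ with hIA
  set IB : Set (BondConfig V) := (openConn a b)ᶜ ∩ (openConn b c)ᶜ with hIB
  set IC : Set (BondConfig V) := (openConn a c)ᶜ ∩ (openConn b c)ᶜ with hIC
  rw [prodBernoulli_real_oneBond (determinedBy_coe_univ Sep) w (Finset.mem_univ e),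
    prodBernoulli_real_oneBond (determinedBy_coe_univ IC) w (Finset.mem_univ e),
    prodBernoulli_real_oneBond (determinedBy_coe_univ IB) w (Finset.mem_univ e),
    prodBernoulli_real_oneBond (determinedBy_coe_univ IA) w (Finset.mem_univ e)]
  -- the `e`-open endpoint in terms of `μ0`
  have hupd : ∀ A : Set (BondConfig V), μ1.real A = μ0.real {ω | insert e ω ∈ A} := fun A => by
    rw [hμ1, hμ0, ← prodBernoulli_real_update_one_eq (determinedBy_coe_univ A) (Function.update w e 0) (Finset.mem_univ e),
      Function.update_idem]
  have q1 : μ1.real Sep = μ0.real (Sep ∩ (openConn a x)ᶜ ∩ (openConn b x)ᶜ) := by rw [hupd, hSep, setOf_insert_mem_sep]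
  have a1 : μ1.real IA = μ0.real (IA ∩ (openConn a x)ᶜ) := by rw [hupd, hIA, setOf_insert_mem_isoA]
  have b1 : μ1.real IB = μ0.real (IB ∩ (openConn b x)ᶜ) := by rw [hupd, hIB, setOf_insert_mem_isoB]
  -- splitting the `e`-closed coordinates
  have sa : μ0.real (IA ∩ openConn a x) + μ0.real (IA ∩ (openConn a x)ᶜ) = μ0.real IA := by
    rw [← sdiff_eq]; exact measureReal_inter_add_sdiff MeasurableSet.of_discrete
  have sb : μ0.real (IB ∩ openConn b x) + μ0.real (IB ∩ (openConn b x)ᶜ) = μ0.real IB := by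
    rw [← sdiff_eq]; exact measureReal_inter_add_sdiff MeasurableSet.of_discrete
  have sq1 : μ0.real (Sep ∩ openConn a x) + μ0.real (Sep ∩ (openConn a x)ᶜ) = μ0.real Sep := by
    rw [← sdiff_eq]; exact measureReal_inter_add_sdiff MeasurableSet.of_discrete
  have sq2 : μ0.real (Sep ∩ (openConn a x)ᶜ ∩ openConn b x) + μ0.real (Sep ∩ (openConn a x)ᶜ ∩ (openConn b x)ᶜ) =
      μ0.real (Sep ∩ (openConn a x)ᶜ) := by
    rw [← sdiff_eq]; exact measureReal_inter_add_sdiff MeasurableSet.of_discrete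
  rw [hSep, sep_inter_compl_inter_eq, ← hSep] at sq2
  -- the termwise (BHK) inequalities at `μ0`
  have ta := lonerAttachment_alone_le_allSep (Function.update w e 0) ({a, b, c} : Finset V) a x (by simp)
  rw [setOf_alone_eq_isoA hab hac, setOf_pairwiseSep_eq hab hac hbc] at ta
  have tb := lonerAttachment_alone_le_allSep (Function.update w e 0) ({a, b, c} : Finset V) b x (by simp)
  rw [setOf_alone_eq_isoB hab hbc, setOf_pairwiseSep_eq hab hac hbc] at tb
  change μ0.real (IA ∩ openConn a x) * μ0.real Sep ≤ μ0.real IA * μ0.real (Sep ∩ openConn a x) at ta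
  change μ0.real (IB ∩ openConn b x) * μ0.real Sep ≤ μ0.real IB * μ0.real (Sep ∩ openConn b x) at tb
  have hr0 : (0 : ℝ) ≤ w e := (w e).2.1
  have hr1 : (w e : ℝ) ≤ 1 := (w e).2.2
  -- the real-variable lemma
  refine asym_onePair_log (dqa := μ0.real (Sep ∩ openConn a x)) (dqb := μ0.real (Sep ∩ openConn b x)) hp hq hpq
    measureReal_nonneg measureReal_nonneg measureReal_nonneg (by linarith)
    (by linarith [a1, sa, (measureReal_nonneg : 0 ≤ μ0.real (IA ∩ openConn a x))])
    (by linarith [b1, sb, (measureReal_nonneg : 0 ≤ μ0.real (IB ∩ openConn b x))]) measureReal_nonneg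
    (measureReal_mono (fun ω hω => hω.1)) (measureReal_mono (fun ω hω => ⟨hω.1.1, hω.2⟩))
    (measureReal_mono (fun ω hω => ⟨hω.1.2, hω.2⟩))
    (measureReal_mono (fun ω hω => hω.1)) (measureReal_mono (fun ω hω => ⟨hω.1.1, hω.2⟩))
    (measureReal_mono (fun ω hω => ⟨hω.1.2, hω.2⟩)) ?_ ?_ h0 h1 hr0 hr1
  · have : μ0.real IA - μ1.real IA = μ0.real (IA ∩ openConn a x) := by linarith [sa, a1]
    rw [this]; linarith [ta]
  · have : μ0.real IB - μ1.real IB = μ0.real (IB ∩ openConn b x) := by linarith [sb, b1]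
    rw [this]; linarith [tb]

/-! ## Induction on the number of fractional pairs -/

/-- **The asymmetric isolation laws on every finite weighted graph (logarithmic form).**  For reals `p, q ≥ 1` with
`p² + pq + q² ≤ pq(p+q)`, bond percolation with arbitrary pair weights on a finite vertex type and any three vertices `a, b, c`:
`Q = 0 ∨ (p+q)·log Q ≤ p·log I_a + q·log I_b + log I_c`. [this work] -/
theorem isoAsymPort_all {p q : ℝ} (hp : 1 ≤ p) (hq : 1 ≤ q) (hpq : p ^ 2 + p * q + q ^ 2 ≤ p * q * (p + q))
    (w : Sym2 V → unitInterval) (a b c : V) :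
    (prodBernoulli w).real ((openConn a b)ᶜ ∩ (openConn a c)ᶜ ∩ (openConn b c)ᶜ) = 0 ∨
      (p + q) * log ((prodBernoulli w).real ((openConn a b)ᶜ ∩ (openConn a c)ᶜ ∩ (openConn b c)ᶜ)) ≤
        p * log ((prodBernoulli w).real ((openConn a b)ᶜ ∩ (openConn a c)ᶜ)) +
          q * log ((prodBernoulli w).real ((openConn a b)ᶜ ∩ (openConn b c)ᶜ)) +
            log ((prodBernoulli w).real ((openConn a c)ᶜ ∩ (openConn b c)ᶜ)) := by
  suffices H : ∀ (n : ℕ) (w : Sym2 V → unitInterval) (a b c : V),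
      (Finset.univ.filter fun f : Sym2 V => (0 : ℝ) < w f ∧ (w f : ℝ) < 1).card = n →
      (prodBernoulli w).real ((openConn a b)ᶜ ∩ (openConn a c)ᶜ ∩ (openConn b c)ᶜ) = 0 ∨
        (p + q) * log ((prodBernoulli w).real ((openConn a b)ᶜ ∩ (openConn a c)ᶜ ∩ (openConn b c)ᶜ)) ≤
          p * log ((prodBernoulli w).real ((openConn a b)ᶜ ∩ (openConn a c)ᶜ)) +
            q * log ((prodBernoulli w).real ((openConn a b)ᶜ ∩ (openConn b c)ᶜ)) +
              log ((prodBernoulli w).real ((openConn a c)ᶜ ∩ (openConn b c)ᶜ)) from H _ w a b c rfl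
  intro n
  induction n using Nat.strong_induction_on with
  | _ n ih =>
  intro w a b c hn
  -- `a = b`: `Q = 0`
  by_cases hab : a = b
  · subst hab
    left
    have : ((openConn a a)ᶜ ∩ (openConn a c)ᶜ ∩ (openConn a c)ᶜ : Set (BondConfig V)) = ∅ := by
      ext ω
      simp only [mem_inter_iff, mem_compl_iff, openConn, mem_setOf_eq, mem_empty_iff_false, iff_false]
      exact fun h => h.1.1 (SimpleGraph.Reachable.refl a)
    rw [this, measureReal_empty]
  -- `a` or `b` surely joined to `c`: `Q = 0`
  by_cases hKa : (openGraph {e : Sym2 V | (w e : ℝ) = 1}).Reachable c a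
  · exact Or.inl (real_sep_eq_zero_of_sure w hKa)
  by_cases hKb : (openGraph {e : Sym2 V | (w e : ℝ) = 1}).Reachable c b
  · left
    have hswap : ((openConn a b)ᶜ ∩ (openConn a c)ᶜ ∩ (openConn b c)ᶜ : Set (BondConfig V)) =
        (openConn b a)ᶜ ∩ (openConn b c)ᶜ ∩ (openConn a c)ᶜ := by
      rw [KNPreFKG.openConn_symm a b]; ext ω; simp only [mem_inter_iff]; tauto
    rw [hswap, real_sep_eq_zero_of_sure w hKb]
  -- a fractional pair leaving the sure component: one-bond step at the port `u`
  by_cases hA : ∃ u x : V, (openGraph {e : Sym2 V | (w e : ℝ) = 1}).Reachable c u ∧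
      ¬ (openGraph {e : Sym2 V | (w e : ℝ) = 1}).Reachable c x ∧ (0 : ℝ) < w s(u, x) ∧ (w s(u, x) : ℝ) < 1
  · obtain ⟨u, x, hu, -, h0, h1⟩ := hA
    have hau : a ≠ u := fun h => hKa (h ▸ hu)
    have hbu : b ≠ u := fun h => hKb (h ▸ hu)
    obtain ⟨eS, eC, eB, eA⟩ := transfer w (a := a) (b := b) (real_openConn_eq_one_of_sure w hu)
    rw [eS, eC, eB, eA]
    refine isoAsymPort_oneBond hp hq hpq w x hab hau hbu ?_ ?_
    · exact ih _ (hn ▸ card_fractional_update_lt w h0 h1 0 (Or.inl rfl)) _ a b u rfl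
    · exact ih _ (hn ▸ card_fractional_update_lt w h0 h1 1 (Or.inr rfl)) _ a b u rfl
  -- no fractional pair leaves the sure component: equality
  · obtain ⟨eC, eS, eB, eA⟩ := coords_of_closedSure w hKa hKb hA
    rw [eC, eS, eB, eA, log_one]
    right
    linarith

/-- **The asymmetric isolation laws on every finite weighted graph (power form).**  For reals `p, q ≥ 1` with `p² + pq + q² ≤ pq(p+q)`,
every finite weighted graph and all vertices `a, b, c`:

  `μ(a|b|c)^{p+q} ≤ μ(a ↮ {b,c})^p · μ(b ↮ {a,c})^q · μ(c ↮ {a,b})`.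

(`p = q = 3/2`: the sextic law `(Q6)`; the boundary curve `pq(p+q) = p²+pq+q²` is parametrised by `p = (1+σ+σ²)/(σ(1+σ))`, `q = σp`.)
[this work] -/
theorem isoAsym_rpow {p q : ℝ} (hp : 1 ≤ p) (hq : 1 ≤ q) (hpq : p ^ 2 + p * q + q ^ 2 ≤ p * q * (p + q))
    (w : Sym2 V → unitInterval) (a b c : V) :
    (prodBernoulli w).real ((openConn a b)ᶜ ∩ (openConn a c)ᶜ ∩ (openConn b c)ᶜ) ^ (p + q) ≤
      (prodBernoulli w).real ((openConn a b)ᶜ ∩ (openConn a c)ᶜ) ^ p *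
        (prodBernoulli w).real ((openConn a b)ᶜ ∩ (openConn b c)ᶜ) ^ q *
          (prodBernoulli w).real ((openConn a c)ᶜ ∩ (openConn b c)ᶜ) := by
  set μ := prodBernoulli w with hμ
  set Q := μ.real ((openConn a b)ᶜ ∩ (openConn a c)ᶜ ∩ (openConn b c)ᶜ) with hQ
  set IA := μ.real ((openConn a b)ᶜ ∩ (openConn a c)ᶜ) with hIA
  set IB := μ.real ((openConn a b)ᶜ ∩ (openConn b c)ᶜ) with hIB
  set IC := μ.real ((openConn a c)ᶜ ∩ (openConn b c)ᶜ) with hIC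
  have hQ0 : 0 ≤ Q := measureReal_nonneg
  have hQA : Q ≤ IA := measureReal_mono (fun ω hω => hω.1)
  have hQB : Q ≤ IB := measureReal_mono (fun ω hω => ⟨hω.1.1, hω.2⟩)
  have hQC : Q ≤ IC := measureReal_mono (fun ω hω => ⟨hω.1.2, hω.2⟩)
  have hpq0 : 0 < p + q := by linarith
  rcases isoAsymPort_all hp hq hpq w a b c with hz | hlog
  · change Q = 0 at hz
    rw [hz, zero_rpow hpq0.ne']
    exact mul_nonneg (mul_nonneg (rpow_nonneg (hQ0.trans hQA) p) (rpow_nonneg (hQ0.trans hQB) q)) (hQ0.trans hQC)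
  · change (p + q) * log Q ≤ p * log IA + q * log IB + log IC at hlog
    rcases hQ0.eq_or_lt with hz | hQp
    · rw [← hz, zero_rpow hpq0.ne']
      exact mul_nonneg (mul_nonneg (rpow_nonneg (hQ0.trans hQA) p) (rpow_nonneg (hQ0.trans hQB) q)) (hQ0.trans hQC)
    have hAp : 0 < IA := lt_of_lt_of_le hQp hQA
    have hBp : 0 < IB := lt_of_lt_of_le hQp hQB
    have hCp : 0 < IC := lt_of_lt_of_le hQp hQC
    rw [rpow_def_of_pos hQp, rpow_def_of_pos hAp, rpow_def_of_pos hBp, ← exp_log hCp, ← exp_add, ← exp_add, exp_le_exp]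
    -- goal: `log Q * (p + q) ≤ log IA * p + log IB * q + log IC`
    linarith

/-- **Sanity corollary: `(Q6)` is the symmetric member.**  `p = q = 3/2` is admissible, and the power form squares to
`Q⁶ ≤ I_c²·I_b³·I_a³` (`ThreePointIsoSexticUniversal.isoSexticPort_all`). Here only the admissibility is recorded. [this work] -/
theorem admissible_three_halves : (1 : ℝ) ≤ 3 / 2 ∧ (1 : ℝ) ≤ 3 / 2 ∧
    (3 / 2 : ℝ) ^ 2 + 3 / 2 * (3 / 2) + (3 / 2) ^ 2 ≤ 3 / 2 * (3 / 2) * (3 / 2 + 3 / 2) := by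
  norm_num

/-- **The `σ`-parametrisation of the boundary curve is admissible**: for every `σ > 0`, `p = (1+σ+σ²)/(σ(1+σ))` and `q = σ·p` satisfy
`p, q ≥ 1` and `p² + pq + q² = pq(p+q)` (so `isoAsym_rpow` applies: `Q^{(1+σ+σ²)/σ} ≤ I_a^{(1+σ+σ²)/(σ(1+σ))} · I_b^{(1+σ+σ²)/(1+σ)} · I_c`,
i.e. `Q^{1+σ} ≤ I_a · I_b^σ · I_c^{σ(1+σ)/(1+σ+σ²)}`). [this work] -/
theorem admissible_sigma {σ : ℝ} (hσ : 0 < σ) :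
    (1 : ℝ) ≤ (1 + σ + σ ^ 2) / (σ * (1 + σ)) ∧ (1 : ℝ) ≤ σ * ((1 + σ + σ ^ 2) / (σ * (1 + σ))) ∧
      ((1 + σ + σ ^ 2) / (σ * (1 + σ))) ^ 2 + (1 + σ + σ ^ 2) / (σ * (1 + σ)) * (σ * ((1 + σ + σ ^ 2) / (σ * (1 + σ)))) +
          (σ * ((1 + σ + σ ^ 2) / (σ * (1 + σ)))) ^ 2 ≤
        (1 + σ + σ ^ 2) / (σ * (1 + σ)) * (σ * ((1 + σ + σ ^ 2) / (σ * (1 + σ)))) *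
          ((1 + σ + σ ^ 2) / (σ * (1 + σ)) + σ * ((1 + σ + σ ^ 2) / (σ * (1 + σ)))) := by
  have hσ1 : 0 < σ * (1 + σ) := mul_pos hσ (by linarith)
  have hq : σ * ((1 + σ + σ ^ 2) / (σ * (1 + σ))) = (1 + σ + σ ^ 2) / (1 + σ) := by
    field_simp
  refine ⟨?_, ?_, ?_⟩
  · rw [le_div_iff₀ hσ1]; nlinarith [sq_nonneg σ]
  · rw [hq, le_div_iff₀ (by linarith : (0 : ℝ) < 1 + σ)]; nlinarith [sq_nonneg σ]
  · rw [hq]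
    have e : ((1 + σ + σ ^ 2) / (σ * (1 + σ))) ^ 2 + (1 + σ + σ ^ 2) / (σ * (1 + σ)) * ((1 + σ + σ ^ 2) / (1 + σ)) +
          ((1 + σ + σ ^ 2) / (1 + σ)) ^ 2 =
        (1 + σ + σ ^ 2) / (σ * (1 + σ)) * ((1 + σ + σ ^ 2) / (1 + σ)) *
          ((1 + σ + σ ^ 2) / (σ * (1 + σ)) + (1 + σ + σ ^ 2) / (1 + σ)) := by
      field_simp
    rw [e]

end Graph

end Summit.CriticalPhenomena.PercolationContinuityZ3.Theorems.ThreePointIsoAsymUniversal
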